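import Mathlib.RingTheory.Valuation.Basic
import Mathlib.Topology.Algebra.Valued.ValuativeRel
import Mathlib.RingTheory.Valuation.Integers
import Mathlib.FieldTheory.Galois.Basic
import HarnessLib

/-!
# Units of the valuation ring generate a valued field; automorphisms fixing the units are trivial

Classical ultrametric algebra (J.-P. Serre, *Local Fields*, GTM 67, Ch. II §3: the unit group `U = 𝒪^×` and
the filtration `U ⊇ 1 + 𝔪`) [cite: SerreLocalFields1979, Ch. II §3]; the sentence it serves in the abc-iut cell
is [EtTh] (S. Mochizuki, *The étale theta function …*, PRIMS 45 (2009)) Theorem 3.7 (iii), PDF p. 79 l. −6 –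
p. 80 l. 8, «`Aut(L/K)` acts faithfully on `𝒪_L^×`» [cite: MochizukiEtTh2009, Thm 3.7 (iii) p.79], recorded in
the cell's GAP-LEDGER row G-w6d058-2 (L2, `LogDivisorModel.GaloisAction.ConstGaloisLaw`, abc-iut-w6-d058) as the
classical input that the v-next «constant field» structure will need «as theorems of Mathlib Galois theory».
PROOF-ONLY, Mathlib-level, no cell interface imported (layer-independent; abc-iut-L6-t8 gen 7 wrote it while
AVAILABLE, as an input offered BY NAME to the L2 lineage):

For ANY valuation `v : Valuation K Γ₀` on a field `K` (no non-triviality, completeness or finiteness needed):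

* `Valuation.eq_one_add_sub_one_of_lt_one` / the two generation facts: every `x` with `v x < 1` is a
  difference of two elements of valuation `1` (`x = (1 + x) − 1`), and every `x` with `1 < v x` is the inverse of
  such an element; hence `Valuation.subfield_closure_valuation_eq_one` — the subfield generated by
  `{x | v x = 1}` (the units of the valuation ring) is ALL of `K`.
* `Valuation.ringHom_eq_of_eqOn_valuation_eq_one` — two ring homomorphisms `K →+* L` into a division ring
  that agree on `{x | v x = 1}` are EQUAL; in particular (`Valuation.ringEquiv_eq_refl_of_forall_valuation_eq_one`)
  a ring automorphism of `K` fixing every element of valuation `1` is the identity, and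
  (`Valuation.algEquiv_eq_one_of_forall_valuation_eq_one`) so is a `k`-algebra automorphism for any base `k` —
  «the automorphism group acts faithfully on the units of the valuation ring»
  (`Valuation.injective_restrict_algEquiv_units`: `σ ↦ (u ↦ σ u)` on `{x | v x = 1}` is injective).
* `ValuativeRel` forms for the tree's local-field files (`valuation K`, `𝒪[K]`):
  `ValuativeRel.ringHom_eq_of_eqOn_units_integer`, `ValuativeRel.algEquiv_eq_one_of_forall_units_integer`
  (hypothesis on the units `u : (𝒪[K])ˣ` of the valuation subring).

Nothing here concerns [IUTchIII]; no side is taken on any disputed claim.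
-/

namespace Literature.NumberTheory.LocalFields

open Valuation

section General

variable {K : Type*} [Field K] {Γ₀ : Type*} [LinearOrderedCommGroupWithZero Γ₀] (v : Valuation K Γ₀)

/-- `x = (1 + x) - 1` with `v (1 + x) = 1` when `v x < 1` (ultrametric inequality, Mathlib
`Valuation.map_one_add_of_lt`): an element of the maximal ideal is a difference of two units of the valuation
ring. [cite: SerreLocalFields1979, Ch. II §3] -/
theorem exists_eq_sub_of_valuation_lt_one {x : K} (hx : v x < 1) :
    ∃ u w : K, v u = 1 ∧ v w = 1 ∧ x = u - w :=
  ⟨1 + x, 1, v.map_one_add_of_lt hx, v.map_one, by ring⟩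

/-- If `1 < v x` then `x⁻¹` has valuation `< 1` (Mathlib `Valuation.one_lt_val_iff`), so `x` is the inverse of a
difference of two units of the valuation ring. [cite: SerreLocalFields1979, Ch. II §3] -/
theorem exists_eq_inv_sub_of_one_lt_valuation {x : K} (hx : 1 < v x) :
    ∃ u w : K, v u = 1 ∧ v w = 1 ∧ x = (u - w)⁻¹ := by
  have hx0 : x ≠ 0 := by rintro rfl; simp at hx
  obtain ⟨u, w, hu, hw, h⟩ := exists_eq_sub_of_valuation_lt_one v ((v.one_lt_val_iff hx0).mp hx)
  exact ⟨u, w, hu, hw, by rw [← h, inv_inv]⟩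

/-- **The units of the valuation ring generate the field**: the subfield of `K` generated by `{x | v x = 1}` is
`⊤`, for ANY valuation `v` on the field `K`. [cite: SerreLocalFields1979, Ch. II §3] -/
theorem subfield_closure_valuation_eq_one : Subfield.closure {x : K | v x = 1} = ⊤ := by
  rw [eq_top_iff]
  intro x _
  have key : ∀ y : K, v y < 1 → y ∈ Subfield.closure {x : K | v x = 1} := by
    intro y hy
    obtain ⟨u, w, hu, hw, rfl⟩ := exists_eq_sub_of_valuation_lt_one v hy
    exact Subfield.sub_mem _ (Subfield.subset_closure hu) (Subfield.subset_closure hw)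
  rcases lt_trichotomy (v x) 1 with hlt | heq | hgt
  · exact key x hlt
  · exact Subfield.subset_closure heq
  · have hx0 : x ≠ 0 := by rintro rfl; simp at hgt
    have hinv : x⁻¹ ∈ Subfield.closure {x : K | v x = 1} := key x⁻¹ ((v.one_lt_val_iff hx0).mp hgt)
    simpa using Subfield.inv_mem _ hinv

/-- **Two ring homomorphisms that agree on the units of the valuation ring are equal** (`K` a field with any
valuation `v`, target any division ring): the kernel form of «`Aut` acts faithfully on `𝒪^×`».
[cite: MochizukiEtTh2009, Thm 3.7 (iii) p.79] -/
theorem ringHom_eq_of_eqOn_valuation_eq_one {L : Type*} [DivisionRing L] (σ τ : K →+* L)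
    (h : ∀ x : K, v x = 1 → σ x = τ x) : σ = τ := by
  have key : ∀ y : K, v y < 1 → σ y = τ y := by
    intro y hy
    have h1 := h (1 + y) (v.map_one_add_of_lt hy)
    rw [map_add, map_add, map_one, map_one] at h1
    exact add_left_cancel h1
  ext x
  rcases lt_trichotomy (v x) 1 with hlt | heq | hgt
  · exact key x hlt
  · exact h x heq
  · have hx0 : x ≠ 0 := by rintro rfl; simp at hgt
    have hinv : σ x⁻¹ = τ x⁻¹ := key x⁻¹ ((v.one_lt_val_iff hx0).mp hgt)
    rw [map_inv₀, map_inv₀] at hinv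
    exact inv_injective hinv

/-- A ring automorphism of a valued field fixing every element of valuation `1` is the identity.
[cite: MochizukiEtTh2009, Thm 3.7 (iii) p.79] -/
theorem ringEquiv_eq_refl_of_forall_valuation_eq_one (σ : K ≃+* K) (h : ∀ x : K, v x = 1 → σ x = x) :
    σ = RingEquiv.refl K := by
  have := ringHom_eq_of_eqOn_valuation_eq_one v σ.toRingHom (RingHom.id K) h
  ext x
  exact RingHom.congr_fun this x

/-- A `k`-algebra automorphism of a valued field `K` fixing every element of valuation `1` is trivial — for a
finite Galois extension `L'/K` of valued fields: «`Aut(L'/K)` acts faithfully on `𝒪_{L'}^×`».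
[cite: MochizukiEtTh2009, Thm 3.7 (iii) p.79] -/
theorem algEquiv_eq_one_of_forall_valuation_eq_one {k : Type*} [Field k] [Algebra k K] (σ : K ≃ₐ[k] K)
    (h : ∀ x : K, v x = 1 → σ x = x) : σ = 1 := by
  have := ringHom_eq_of_eqOn_valuation_eq_one v (σ : K →+* K) (RingHom.id K) h
  ext x
  exact RingHom.congr_fun this x

/-- FAITHFULNESS as injectivity: restricting `k`-algebra automorphisms of `K` to the set of elements of valuation
`1` is injective. [cite: MochizukiEtTh2009, Thm 3.7 (iii) p.79] -/
theorem injective_restrict_algEquiv_valuation_eq_one {k : Type*} [Field k] [Algebra k K] :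
    Function.Injective (fun (σ : K ≃ₐ[k] K) (u : {x : K // v x = 1}) => σ u.1) := by
  intro σ τ hστ
  have key : ∀ x : K, v x = 1 → (σ⁻¹ * τ) x = x := by
    intro x hx
    have := congrFun hστ ⟨x, hx⟩
    simp only at this
    change σ.symm (τ x) = x
    rw [← this, AlgEquiv.symm_apply_apply]
  have h1 : σ⁻¹ * τ = 1 := algEquiv_eq_one_of_forall_valuation_eq_one v (σ⁻¹ * τ) key
  calc σ = σ * (σ⁻¹ * τ) := by rw [h1, mul_one]
    _ = τ := by rw [← mul_assoc, mul_inv_cancel, one_mul]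

end General

section Local

open ValuativeRel

variable {K : Type*} [Field K] [ValuativeRel K]

/-- `ValuativeRel` form (the tree's local-field vocabulary `valuation K`, `𝒪[K]`): two ring homomorphisms out of
`K` that agree on the units `(𝒪[K])ˣ` of the valuation ring are equal. [cite: MochizukiEtTh2009, Thm 3.7 (iii) p.79] -/
theorem ringHom_eq_of_eqOn_units_integer {L : Type*} [DivisionRing L] (σ τ : K →+* L)
    (h : ∀ u : (𝒪[K])ˣ, σ (u : 𝒪[K]) = τ (u : 𝒪[K])) : σ = τ := by
  refine ringHom_eq_of_eqOn_valuation_eq_one (valuation K) σ τ fun x hx => ?_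
  have hxO : x ∈ 𝒪[K] := (Valuation.mem_integer_iff _ _).mpr hx.le
  have hu : IsUnit (⟨x, hxO⟩ : 𝒪[K]) :=
    (Valuation.integer.integers (valuation K)).isUnit_iff_valuation_eq_one.mpr hx
  obtain ⟨u, hu⟩ := hu
  have := h u
  rwa [hu] at this

/-- `ValuativeRel` form: a `k`-algebra automorphism of `K` fixing every unit of `𝒪[K]` is trivial — «`Aut(L/K)`
acts faithfully on `𝒪_L^×`». [cite: MochizukiEtTh2009, Thm 3.7 (iii) p.79] -/
theorem algEquiv_eq_one_of_forall_units_integer {k : Type*} [Field k] [Algebra k K] (σ : K ≃ₐ[k] K)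
    (h : ∀ u : (𝒪[K])ˣ, σ (u : 𝒪[K]) = (u : 𝒪[K])) : σ = 1 := by
  have := ringHom_eq_of_eqOn_units_integer (σ : K →+* K) (RingHom.id K) h
  ext x
  exact RingHom.congr_fun this x

/-- `ValuativeRel` form: the subfield generated by the units of `𝒪[K]` is all of `K`.
[cite: SerreLocalFields1979, Ch. II §3] -/
theorem subfield_closure_units_integer :
    Subfield.closure ((fun u : (𝒪[K])ˣ => ((u : 𝒪[K]) : K)) '' Set.univ) = ⊤ := by
  rw [eq_top_iff, ← subfield_closure_valuation_eq_one (valuation K)]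
  apply Subfield.closure_mono
  intro x hx
  have hxO : x ∈ 𝒪[K] := (Valuation.mem_integer_iff _ _).mpr (le_of_eq hx)
  have hu : IsUnit (⟨x, hxO⟩ : 𝒪[K]) :=
    (Valuation.integer.integers (valuation K)).isUnit_iff_valuation_eq_one.mpr hx
  obtain ⟨u, hu⟩ := hu
  exact ⟨u, Set.mem_univ _, by simp only [hu]⟩

end Local

end Literature.NumberTheory.LocalFields
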